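import Mathlib.Analysis.SpecialFunctions.Pow.Asymptotics
import Mathlib.Analysis.SpecialFunctions.Log.Basic
import Mathlib.Analysis.SpecialFunctions.Exponential
import HarnessLib

/-!
# Growth lemmas for the Linnik range ("after some calculations", Granville–Mollin §3)

Topic `Literature/NumberTheory/LFunctions`, sub-namespace `SiegelZero`. Everything in this file is
PROVED (elementary real analysis, no number theory). Granville–Mollin, *Rabinowitsch revisited*,
§3, deduce (3.3) from (3.1)–(3.2) "with `T = |d| log³x` … for `x > |d|^C` … (after some
calculations when `x > e^{|d|}`)". With `L = log x`, `q < e^{L/9}` and `T = qL³`, every secondary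
term of the explicit formula is compared with `x/(qL)` through an inequality of the shape
`A Lᵏ ≤ e^{aL}` or `A log L · L⁴ e^{−cL/(6 log L)} ≤ 1`, valid for `L ≥ L₀`; this file proves these
and collects the thresholds used by `GranvilleMollinLinnikProofs.lean` in `exists_linnikRange_threshold`.
[cite: GranvilleMollin2000, §3 (3.3)]
-/

noncomputable section

open Filter Asymptotics Real

namespace Literature.NumberTheory.LFunctions.SiegelZero

/-- `A Lᵏ ≤ e^{aL}` for `L ≥ L₀` (`a > 0`, real exponent `k`). [folklore] -/
theorem exists_mul_rpow_le_exp (A k a : ℝ) (ha : 0 < a) :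
    ∃ L₀ : ℝ, 0 ≤ L₀ ∧ ∀ L : ℝ, L₀ ≤ L → A * L ^ k ≤ Real.exp (a * L) := by
  rcases le_or_gt A 0 with hA | hA
  · refine ⟨0, le_rfl, fun L hL ↦ ?_⟩
    exact (mul_nonpos_of_nonpos_of_nonneg hA (Real.rpow_nonneg hL k)).trans (Real.exp_pos _).le
  · have h := (isLittleO_rpow_exp_pos_mul_atTop k ha).bound (inv_pos.2 hA)
    obtain ⟨L₀, hL₀⟩ := Filter.eventually_atTop.1 h
    refine ⟨max L₀ 0, le_max_right _ _, fun L hL ↦ ?_⟩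
    have hL0 : 0 ≤ L := (le_max_right _ _).trans hL
    have h1 := hL₀ L ((le_max_left _ _).trans hL)
    rw [Real.norm_of_nonneg (Real.rpow_nonneg hL0 k), Real.norm_of_nonneg (Real.exp_pos _).le]
      at h1
    calc A * L ^ k ≤ A * (A⁻¹ * Real.exp (a * L)) := by gcongr
      _ = Real.exp (a * L) := by field_simp

/-- `A Lⁿ ≤ e^{aL}` for `L ≥ L₀` (`a > 0`, natural exponent `n`). [folklore] -/
theorem exists_mul_pow_le_exp (A : ℝ) (n : ℕ) (a : ℝ) (ha : 0 < a) :
    ∃ L₀ : ℝ, 0 ≤ L₀ ∧ ∀ L : ℝ, L₀ ≤ L → A * L ^ n ≤ Real.exp (a * L) := by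
  obtain ⟨L₀, hL₀, h⟩ := exists_mul_rpow_le_exp A n a ha
  exact ⟨L₀, hL₀, fun L hL ↦ by simpa [Real.rpow_natCast] using h L hL⟩

/-- `log L ≤ L/4` for `L ≥ L₀`. [folklore] -/
theorem exists_log_le_div_four : ∃ L₀ : ℝ, 1 ≤ L₀ ∧ ∀ L : ℝ, L₀ ≤ L → Real.log L ≤ L / 4 := by
  obtain ⟨L₀, hL₀, h⟩ := exists_mul_pow_le_exp 1 1 (1 / 4) (by norm_num)
  refine ⟨max L₀ 1, le_max_right _ _, fun L hL ↦ ?_⟩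
  have hL1 : 1 ≤ L := (le_max_right _ _).trans hL
  have h1 := h L ((le_max_left _ _).trans hL)
  rw [one_mul, pow_one] at h1
  calc Real.log L ≤ Real.log (Real.exp (1 / 4 * L)) := Real.log_le_log (by linarith) h1
    _ = L / 4 := by rw [Real.log_exp]; ring

/-- `(log L)² ≤ aL` for `L ≥ L₀` (`a > 0`). [folklore] -/
theorem exists_log_sq_le_mul (a : ℝ) (ha : 0 < a) :
    ∃ L₀ : ℝ, 1 ≤ L₀ ∧ ∀ L : ℝ, L₀ ≤ L → Real.log L ^ 2 ≤ a * L := by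
  have h := (Real.isLittleO_pow_log_id_atTop (n := 2)).bound ha
  obtain ⟨L₀, hL₀⟩ := Filter.eventually_atTop.1 h
  refine ⟨max L₀ 1, le_max_right _ _, fun L hL ↦ ?_⟩
  have hL1 : 1 ≤ L := (le_max_right _ _).trans hL
  have h1 := hL₀ L ((le_max_left _ _).trans hL)
  rw [id, Real.norm_of_nonneg (sq_nonneg _), Real.norm_of_nonneg (by linarith)] at h1
  exact h1

/-- **The `δ`-term beyond the Linnik range**: `A log L · L⁴ · e^{−aL/(6 log L)} ≤ 1` for `L ≥ L₀`
(`a > 0`): for `L` large, `aL/(6 log L) ≥ 6 log L`, so the left side is `≤ A log L / L² ≤ A/L`.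
[folklore] -/
theorem exists_deltaTerm_le_one (A a : ℝ) (ha : 0 < a) :
    ∃ L₀ : ℝ, 1 ≤ L₀ ∧ ∀ L : ℝ, L₀ ≤ L →
      A * Real.log L * L ^ 4 * Real.exp (-(a * L / (6 * Real.log L))) ≤ 1 := by
  obtain ⟨L₁, hL₁, h1⟩ := exists_log_sq_le_mul (a / 36) (by positivity)
  refine ⟨max (max L₁ (Real.exp 1)) (max A 1), (le_max_right _ _).trans (le_max_right _ _),
    fun L hL ↦ ?_⟩
  have hLA : A ≤ L := (le_max_left _ _).trans ((le_max_right _ _).trans hL)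
  have hL1 : 1 ≤ L := (le_max_right _ _).trans ((le_max_right _ _).trans hL)
  have hLe : Real.exp 1 ≤ L := (le_max_right _ _).trans ((le_max_left _ _).trans hL)
  have hL0 : 0 < L := by linarith
  have hlog1 : 1 ≤ Real.log L := by
    rw [← Real.log_exp 1]; exact Real.log_le_log (Real.exp_pos 1) hLe
  have hlog0 : 0 < Real.log L := by linarith
  have hlogL : Real.log L ≤ L := (Real.log_le_sub_one_of_pos hL0).trans (by linarith)
  -- `a L /(6 log L) ≥ 6 log L`
  have hsq := h1 L ((le_max_left _ _).trans ((le_max_left _ _).trans hL))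
  have hexp : Real.exp (-(a * L / (6 * Real.log L))) ≤ (L ^ 6)⁻¹ := by
    have h6 : 6 * Real.log L ≤ a * L / (6 * Real.log L) := by
      rw [le_div_iff₀ (by positivity)]; nlinarith
    calc Real.exp (-(a * L / (6 * Real.log L))) ≤ Real.exp (-(6 * Real.log L)) :=
          Real.exp_le_exp.2 (by linarith)
      _ = (L ^ 6)⁻¹ := by
          rw [Real.exp_neg, show (6 : ℝ) * Real.log L = ((6 : ℕ) : ℝ) * Real.log L by norm_num,
            Real.exp_nat_mul, Real.exp_log hL0]
  rcases le_or_gt A 0 with hA | hA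
  · have : A * Real.log L * L ^ 4 * Real.exp (-(a * L / (6 * Real.log L))) ≤ 0 :=
      mul_nonpos_of_nonpos_of_nonneg
        (mul_nonpos_of_nonpos_of_nonneg (mul_nonpos_of_nonpos_of_nonneg hA hlog0.le)
          (by positivity)) (Real.exp_pos _).le
    linarith
  calc A * Real.log L * L ^ 4 * Real.exp (-(a * L / (6 * Real.log L)))
      ≤ A * Real.log L * L ^ 4 * (L ^ 6)⁻¹ := by gcongr
    _ ≤ A * L * L ^ 4 * (L ^ 6)⁻¹ := by gcongr
    _ = A / L := by field_simp
    _ ≤ 1 := by rw [div_le_one hL0]; exact hLA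

/-- **The thresholds of the Linnik-range calculation.** For the constants of the proof of
Granville–Mollin's (3.3) (the exponents `9 < C' < C`, and the constants `K₁, K₂, C_S, K_J, c₀,
C₅, c, T₀` of the explicit formula, of (3.2), of Siegel's theorem, of the Jensen count, of the
small-zero bound and of the bound for `C(χ)`), there is `L₀ ≥ 2` beyond which all the elementary
inequalities used with `L = log x` hold. [cite: GranvilleMollin2000, §3 (3.3)] -/
theorem exists_linnikRange_threshold (C C' K₁ K₂ CS KJ c₀ C₅ c T₀ : ℝ) (hC'C : C' < C) (hC' : 9 < C')
    (hc : 0 < c) :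
    ∃ L₀ : ℝ, 18 ≤ L₀ ∧ ∀ L : ℝ, L₀ ≤ L →
      L ^ (3 * C') ≤ Real.exp ((1 - C' / C) * L) ∧
      T₀ ≤ L ^ 3 ∧
      Real.log L ≤ L / 4 ∧
      2 * L ^ 2 ≤ Real.exp (7 / 18 * L) ∧
      (K₁ + 10) * L ^ 2 ≤ Real.exp (8 / 9 * L) ∧
      CS⁻¹ * L ≤ Real.exp (2 / 3 * L) ∧
      4 * K₂ * L ^ 10 ≤ Real.exp (1 / 18 * L) ∧
      24 * K₂ * Real.log L * L ^ 4 * Real.exp (-(c * L / (6 * Real.log L))) ≤ 1 ∧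
      KJ / c₀ * L ^ 3 ≤ Real.exp (23 / 36 * L) ∧
      C₅ * (CS⁻¹ + 1) * L ^ 5 ≤ Real.exp (7 / 9 * L) := by
  have hC0 : 0 < C := by linarith
  have ha1 : 0 < 1 - C' / C := by
    rw [sub_pos, div_lt_one hC0]; exact hC'C
  obtain ⟨A₁, -, h₁⟩ := exists_mul_rpow_le_exp 1 (3 * C') (1 - C' / C) ha1
  obtain ⟨A₃, -, h₃⟩ := exists_log_le_div_four
  obtain ⟨A₄, -, h₄⟩ := exists_mul_pow_le_exp 2 2 (7 / 18) (by norm_num)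
  obtain ⟨A₅, -, h₅⟩ := exists_mul_pow_le_exp (K₁ + 10) 2 (8 / 9) (by norm_num)
  obtain ⟨A₆, -, h₆⟩ := exists_mul_pow_le_exp CS⁻¹ 1 (2 / 3) (by norm_num)
  obtain ⟨A₇, -, h₇⟩ := exists_mul_pow_le_exp (4 * K₂) 10 (1 / 18) (by norm_num)
  obtain ⟨A₈, -, h₈⟩ := exists_deltaTerm_le_one (24 * K₂) c hc
  obtain ⟨A₉, -, h₉⟩ := exists_mul_pow_le_exp (KJ / c₀) 3 (23 / 36) (by norm_num)
  obtain ⟨A₁₀, -, h₁₀⟩ := exists_mul_pow_le_exp (C₅ * (CS⁻¹ + 1)) 5 (7 / 9) (by norm_num)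
  set L₀ : ℝ := max (max (max (max A₁ (max T₀ 18)) (max A₃ A₄)) (max (max A₅ A₆) (max A₇ A₈)))
    (max A₉ A₁₀) with hL₀
  refine ⟨L₀, ?_, fun L hL ↦ ?_⟩
  · exact (le_max_right _ _).trans ((le_max_right _ _).trans
      ((le_max_left _ _).trans ((le_max_left _ _).trans (le_max_left _ _))))
  have g1 : max (max (max A₁ (max T₀ 18)) (max A₃ A₄)) (max (max A₅ A₆) (max A₇ A₈)) ≤ L :=
    (le_max_left _ _).trans hL
  have g2 : max A₉ A₁₀ ≤ L := (le_max_right _ _).trans hL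
  have gA₁ : A₁ ≤ L := (le_max_left _ _).trans ((le_max_left _ _).trans ((le_max_left _ _).trans g1))
  have gT : max T₀ 18 ≤ L :=
    (le_max_right _ _).trans ((le_max_left _ _).trans ((le_max_left _ _).trans g1))
  have gT₀ : T₀ ≤ L := (le_max_left _ _).trans gT
  have g2' : 18 ≤ L := (le_max_right _ _).trans gT
  have gA₃ : A₃ ≤ L := (le_max_left _ _).trans ((le_max_right _ _).trans ((le_max_left _ _).trans g1))
  have gA₄ : A₄ ≤ L := (le_max_right _ _).trans ((le_max_right _ _).trans ((le_max_left _ _).trans g1))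
  have gA₅ : A₅ ≤ L := (le_max_left _ _).trans ((le_max_left _ _).trans ((le_max_right _ _).trans g1))
  have gA₆ : A₆ ≤ L := (le_max_right _ _).trans ((le_max_left _ _).trans ((le_max_right _ _).trans g1))
  have gA₇ : A₇ ≤ L := (le_max_left _ _).trans ((le_max_right _ _).trans ((le_max_right _ _).trans g1))
  have gA₈ : A₈ ≤ L := (le_max_right _ _).trans ((le_max_right _ _).trans ((le_max_right _ _).trans g1))
  have gA₉ : A₉ ≤ L := (le_max_left _ _).trans g2
  have gA₁₀ : A₁₀ ≤ L := (le_max_right _ _).trans g2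
  refine ⟨by simpa using h₁ L gA₁, ?_, h₃ L gA₃, h₄ L gA₄, h₅ L gA₅, by simpa using h₆ L gA₆,
    h₇ L gA₇, h₈ L gA₈, h₉ L gA₉, h₁₀ L gA₁₀⟩
  calc T₀ ≤ L := gT₀
    _ ≤ L ^ 3 := by
        calc L = L ^ 1 := (pow_one L).symm
          _ ≤ L ^ 3 := pow_le_pow_right₀ (by linarith) (by norm_num)

/-! ## The individual comparisons with `x/(qL)`

Throughout `x = e^L`, `1 ≤ q ≤ e^{L/9}` (i.e. `x ≥ q⁹`), `T = qL³`. -/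

section Terms

variable {L q x : ℝ}

/-- The prime powers: `2√x · L ≤ x/(qL)`. [folklore] -/
theorem sqrt_term_le (hx : x = Real.exp L) (hq1 : 1 ≤ q) (hqL : q ≤ Real.exp (L / 9))
    (hL : 1 ≤ L) (h : 2 * L ^ 2 ≤ Real.exp (7 / 18 * L)) :
    2 * Real.sqrt x * L ≤ x / (q * L) := by
  have hq0 : 0 < q := by linarith
  rw [le_div_iff₀ (by positivity), hx, ← Real.exp_half]
  have e : Real.exp (7 / 18 * L) * Real.exp (L / 9) * Real.exp (L / 2) = Real.exp L := by
    rw [← Real.exp_add, ← Real.exp_add]; ring_nf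
  calc 2 * Real.exp (L / 2) * L * (q * L) = 2 * L ^ 2 * q * Real.exp (L / 2) := by ring
    _ ≤ Real.exp (7 / 18 * L) * Real.exp (L / 9) * Real.exp (L / 2) := by gcongr
    _ = Real.exp L := e

/-- The terms of size `≪ L`: `(K + 10) L ≤ x/(qL)`. [folklore] -/
theorem linear_term_le (hx : x = Real.exp L) (hq1 : 1 ≤ q) (hqL : q ≤ Real.exp (L / 9))
    (hL : 1 ≤ L) {K : ℝ} (h : (K + 10) * L ^ 2 ≤ Real.exp (8 / 9 * L)) :
    (K + 10) * L ≤ x / (q * L) := by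
  have hq0 : 0 < q := by linarith
  rw [le_div_iff₀ (by positivity), hx]
  have e : Real.exp (8 / 9 * L) * Real.exp (L / 9) = Real.exp L := by
    rw [← Real.exp_add]; ring_nf
  calc (K + 10) * L * (q * L) = (K + 10) * L ^ 2 * q := by ring
    _ ≤ Real.exp (8 / 9 * L) * Real.exp (L / 9) := by gcongr
    _ = Real.exp L := e

/-- The truncation error of the explicit formula: `(x/T) log²(qxT) ≤ 9x/(qL)` for `T = qL³`
(`log(qxT) = 2 log q + 3 log L + L ≤ 3L`). [folklore] -/
theorem truncation_term_le (hx : x = Real.exp L) (hq1 : 1 ≤ q) (hlogq : Real.log q ≤ L / 9)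
    (hL : 1 ≤ L) (hlogL : Real.log L ≤ L / 4) {T : ℝ} (hT : T = q * L ^ 3) :
    x / T * Real.log (q * x * T) ^ 2 ≤ 9 * (x / (q * L)) := by
  have hq0 : 0 < q := by linarith
  have hL0 : 0 < L := by linarith
  have hx0 : 0 < x := by rw [hx]; exact Real.exp_pos L
  have hlogq0 : 0 ≤ Real.log q := Real.log_nonneg hq1
  have hlogL0 : 0 ≤ Real.log L := Real.log_nonneg hL
  have hlog : Real.log (q * x * T) = 2 * Real.log q + L + 3 * Real.log L := by
    rw [hT, Real.log_mul (by positivity) (by positivity), Real.log_mul hq0.ne' hx0.ne',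
      Real.log_mul hq0.ne' (by positivity), Real.log_pow, hx, Real.log_exp]
    push_cast; ring
  have h3 : Real.log (q * x * T) ≤ 3 * L := by rw [hlog]; linarith
  have h0 : 0 ≤ Real.log (q * x * T) := by rw [hlog]; positivity
  have hsq : Real.log (q * x * T) ^ 2 ≤ (3 * L) ^ 2 := pow_le_pow_left₀ h0 h3 2
  have hT0 : 0 < T := by rw [hT]; positivity
  calc x / T * Real.log (q * x * T) ^ 2 ≤ x / T * (3 * L) ^ 2 := by gcongr
    _ = 9 * (x / (q * L)) := by rw [hT]; field_simp; ring

/-- The zero `1 − β`: `x^ν · (q/C_S) ≤ x/(qL)` (`ν = 1 − β ≤ 1/9`; Siegel's bound gives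
`1/(1 − β) ≤ q/C_S`). [folklore] -/
theorem smallPower_term_le (hx : x = Real.exp L) (hq1 : 1 ≤ q) (hqL : q ≤ Real.exp (L / 9))
    (hL : 1 ≤ L) {ν CS : ℝ} (hν : ν ≤ 1 / 9) (hCS : 0 < CS)
    (h : CS⁻¹ * L ≤ Real.exp (2 / 3 * L)) :
    x ^ ν * (q / CS) ≤ x / (q * L) := by
  have hq0 : 0 < q := by linarith
  have hx1 : 1 ≤ x := by rw [hx]; exact Real.one_le_exp (by linarith)
  have hxν : x ^ ν ≤ Real.exp (L / 9) := by
    calc x ^ ν ≤ x ^ (1 / 9 : ℝ) := Real.rpow_le_rpow_of_exponent_le hx1 hν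
      _ = Real.exp (L / 9) := by rw [hx, ← Real.exp_mul]; ring_nf
  have hL' : L ≤ CS * Real.exp (2 / 3 * L) := by
    have := mul_le_mul_of_nonneg_left h hCS.le
    rwa [← mul_assoc, mul_inv_cancel₀ hCS.ne', one_mul] at this
  have hx0 : 0 < x := by rw [hx]; exact Real.exp_pos L
  rw [le_div_iff₀ (by positivity)]
  have e : Real.exp (L / 9) * Real.exp (L / 9) * Real.exp (2 / 3 * L) * Real.exp (L / 9) =
      Real.exp L := by
    rw [← Real.exp_add, ← Real.exp_add, ← Real.exp_add]; ring_nf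
  calc x ^ ν * (q / CS) * (q * L) = x ^ ν * q * L / CS * q := by field_simp
    _ ≤ Real.exp (L / 9) * Real.exp (L / 9) * (CS * Real.exp (2 / 3 * L)) / CS *
          Real.exp (L / 9) := by gcongr
    _ = Real.exp L := by
        rw [show Real.exp (L / 9) * Real.exp (L / 9) * (CS * Real.exp (2 / 3 * L)) / CS =
          Real.exp (L / 9) * Real.exp (L / 9) * Real.exp (2 / 3 * L) by field_simp, e]
    _ = x := hx.symm

/-- The `x^{1/2}T³` term of (3.2): `4K x^{1/2} T³ ≤ x/(qL)` for `T = qL³` (this is where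
`x > q⁹` is used: `q⁴ < x^{4/9} < x^{1/2}`). [folklore] -/
theorem density_term_le (hx : x = Real.exp L) (hq1 : 1 ≤ q) (hqL : q ≤ Real.exp (L / 9))
    (hL : 1 ≤ L) {K T : ℝ} (hT : T = q * L ^ 3)
    (h : 4 * K * L ^ 10 ≤ Real.exp (1 / 18 * L)) :
    4 * K * (x ^ (1 / 2 : ℝ) * T ^ (3 : ℝ)) ≤ x / (q * L) := by
  have hq0 : 0 < q := by linarith
  have hT3 : T ^ (3 : ℝ) = q ^ 3 * L ^ 9 := by
    rw [show (3 : ℝ) = ((3 : ℕ) : ℝ) by norm_num, Real.rpow_natCast, hT]; ring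
  have hxhalf : x ^ (1 / 2 : ℝ) = Real.exp (L / 2) := by
    rw [hx, ← Real.exp_mul]; ring_nf
  have hq4 : q ^ 4 ≤ Real.exp (4 / 9 * L) := by
    calc q ^ 4 ≤ Real.exp (L / 9) ^ 4 := pow_le_pow_left₀ hq0.le hqL 4
      _ = Real.exp (4 / 9 * L) := by rw [← Real.exp_nat_mul]; ring_nf
  rw [le_div_iff₀ (by positivity), hT3, hxhalf, hx]
  have e : Real.exp (1 / 18 * L) * Real.exp (4 / 9 * L) * Real.exp (L / 2) = Real.exp L := by
    rw [← Real.exp_add, ← Real.exp_add]; ring_nf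
  calc 4 * K * (Real.exp (L / 2) * (q ^ 3 * L ^ 9)) * (q * L) =
        4 * K * L ^ 10 * q ^ 4 * Real.exp (L / 2) := by ring
    _ ≤ Real.exp (1 / 18 * L) * Real.exp (4 / 9 * L) * Real.exp (L / 2) := by gcongr
    _ = Real.exp L := e

/-- The `δ`-term in the Linnik range (`3 log L ≤ log q`, so `log T ≤ 2 log q`):
`4K (1 − β)(log T) x^{1 − c/log T} ≤ 8K x^{1 − (c/2)/log q}/η` with `1 − β = 1/(η log q)`.
[folklore] -/
theorem delta_term_le_of_le (hx1 : 1 ≤ x) {K η c β T : ℝ} (hK : 0 ≤ K) (hη : 0 < η)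
    (hc : 0 < c) (hlogq : 1 ≤ Real.log q) (hβ : 1 - β = 1 / (η * Real.log q))
    (hlogT : Real.log T = Real.log q + 3 * Real.log L) (hlogL : 0 ≤ Real.log L)
    (hcase : 3 * Real.log L ≤ Real.log q) :
    4 * K * ((1 - β) * Real.log T * x ^ (1 - c / Real.log T)) ≤
      8 * K * (x ^ (1 - c / 2 / Real.log q) / η) := by
  have hlogT2 : Real.log T ≤ 2 * Real.log q := by rw [hlogT]; linarith
  have hlogT0 : 0 < Real.log T := by rw [hlogT]; linarith
  have hpow : x ^ (1 - c / Real.log T) ≤ x ^ (1 - c / 2 / Real.log q) := by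
    refine Real.rpow_le_rpow_of_exponent_le hx1 ?_
    have : c / 2 / Real.log q ≤ c / Real.log T := by
      rw [div_div, div_le_div_iff_of_pos_left hc (by positivity) hlogT0]; linarith
    linarith
  have hfac : (1 - β) * Real.log T ≤ 2 / η := by
    rw [hβ]
    calc 1 / (η * Real.log q) * Real.log T ≤ 1 / (η * Real.log q) * (2 * Real.log q) := by
          gcongr
      _ = 2 / η := by field_simp
  have hpos : 0 ≤ x ^ (1 - c / 2 / Real.log q) := Real.rpow_nonneg (by linarith) _
  have h1β : 0 ≤ (1 - β) * Real.log T := by rw [hβ]; positivity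
  calc 4 * K * ((1 - β) * Real.log T * x ^ (1 - c / Real.log T))
      ≤ 4 * K * ((2 / η) * x ^ (1 - c / 2 / Real.log q)) := by gcongr
    _ = 8 * K * (x ^ (1 - c / 2 / Real.log q) / η) := by ring

/-- The `δ`-term beyond the Linnik range (`log q < 3 log L`, so `q < L³` and `log T < 6 log L`):
`4K (1 − β)(log T) x^{1 − c/log T} ≤ 24K log L · x e^{−cL/(6 log L)} ≤ x/(qL)`. [folklore] -/
theorem delta_term_le_of_lt (hx : x = Real.exp L) (hq1 : 1 ≤ q) (hL : 18 ≤ L) {K c β T : ℝ}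
    (hK : 0 ≤ K) (hc : 0 < c) (hβ0 : 0 ≤ 1 - β) (hβ1 : 1 - β ≤ 1)
    (hlogT : Real.log T = Real.log q + 3 * Real.log L) (hcase : Real.log q < 3 * Real.log L)
    (h : 24 * K * Real.log L * L ^ 4 * Real.exp (-(c * L / (6 * Real.log L))) ≤ 1) :
    4 * K * ((1 - β) * Real.log T * x ^ (1 - c / Real.log T)) ≤ x / (q * L) := by
  have hq0 : 0 < q := by linarith
  have hL1 : 1 < L := by linarith
  have hL0 : 0 < L := by linarith
  have hx0 : 0 < x := by rw [hx]; exact Real.exp_pos L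
  have hlogL : 0 < Real.log L := Real.log_pos hL1
  have hlogq0 : 0 ≤ Real.log q := Real.log_nonneg hq1
  have hlogT6 : Real.log T ≤ 6 * Real.log L := by rw [hlogT]; linarith
  have hlogT0 : 0 < Real.log T := by rw [hlogT]; linarith
  have hqL3 : q ≤ L ^ 3 := by
    have : Real.log q ≤ Real.log (L ^ 3) := by rw [Real.log_pow]; push_cast; linarith
    exact (Real.log_le_log_iff hq0 (by positivity)).1 this
  -- `x^{1 - c/log T} = x · e^{-cL/log T} ≤ x · e^{-cL/(6 log L)}`
  have hpow : x ^ (1 - c / Real.log T) ≤ x * Real.exp (-(c * L / (6 * Real.log L))) := by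
    rw [Real.rpow_def_of_pos hx0, show Real.log x = L by rw [hx, Real.log_exp],
      show L * (1 - c / Real.log T) = L + -(c * L / Real.log T) by ring, Real.exp_add, ← hx]
    refine mul_le_mul_of_nonneg_left (Real.exp_le_exp.2 ?_) hx0.le
    rw [neg_le_neg_iff, div_le_div_iff_of_pos_left (by positivity) (by positivity) hlogT0]
    exact hlogT6
  have hfac : (1 - β) * Real.log T ≤ 6 * Real.log L := by nlinarith
  rw [le_div_iff₀ (by positivity)]
  calc 4 * K * ((1 - β) * Real.log T * x ^ (1 - c / Real.log T)) * (q * L)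
      ≤ 4 * K * (6 * Real.log L * (x * Real.exp (-(c * L / (6 * Real.log L))))) * (L ^ 3 * L) := by
        gcongr
    _ = x * (24 * K * Real.log L * L ^ 4 * Real.exp (-(c * L / (6 * Real.log L)))) := by ring
    _ ≤ x * 1 := by gcongr
    _ = x := mul_one x

/-- The small zeros: `x^{1/4} (K_J(log q + log 4)) / (c₀/(log q + log 5)) ≤ x/(qL)`. [folklore] -/
theorem smallZeros_term_le (hx : x = Real.exp L) (hq1 : 1 ≤ q) (hqL : q ≤ Real.exp (L / 9))
    (hlogq : Real.log q ≤ L / 9) (hL : 18 ≤ L) {KJ c₀ : ℝ} (hKJ : 0 ≤ KJ) (hc₀ : 0 < c₀)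
    (h : KJ / c₀ * L ^ 3 ≤ Real.exp (23 / 36 * L)) :
    x ^ (1 / 4 : ℝ) / (c₀ / (Real.log q + Real.log 5)) * (KJ * (Real.log q + Real.log 4)) ≤
      x / (q * L) := by
  have hq0 : 0 < q := by linarith
  have hL0 : 0 < L := by linarith
  have hlogq0 : 0 ≤ Real.log q := Real.log_nonneg hq1
  have hl5 : Real.log 5 ≤ 2 := by
    have h5 : (5 : ℝ) ≤ Real.exp 2 := by
      have := Real.quadratic_le_exp_of_nonneg (show (0 : ℝ) ≤ 2 by norm_num)
      linarith
    calc Real.log 5 ≤ Real.log (Real.exp 2) := Real.log_le_log (by norm_num) h5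
      _ = 2 := Real.log_exp 2
  have hl5' : 0 < Real.log 5 := Real.log_pos (by norm_num)
  have hl4 : Real.log 4 ≤ 3 := by
    have := Real.log_le_sub_one_of_pos (show (0 : ℝ) < 4 by norm_num); linarith
  have hl4' : 0 < Real.log 4 := Real.log_pos (by norm_num)
  have hA : Real.log q + Real.log 4 ≤ L := by linarith
  have hB : Real.log q + Real.log 5 ≤ L := by linarith
  have hxq : x ^ (1 / 4 : ℝ) = Real.exp (L / 4) := by rw [hx, ← Real.exp_mul]; ring_nf
  rw [hxq, div_div_eq_mul_div, div_mul_eq_mul_div, div_le_div_iff₀ hc₀ (by positivity)]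
  have e : Real.exp (L / 4) * (c₀ * Real.exp (23 / 36 * L)) * Real.exp (L / 9) = x * c₀ := by
    rw [hx, show Real.exp L * c₀ = c₀ * Real.exp L by ring, mul_comm c₀, ← mul_assoc,
      mul_assoc (Real.exp (L / 4) * Real.exp (23 / 36 * L)), mul_comm c₀, ← mul_assoc,
      ← Real.exp_add, ← Real.exp_add]
    ring_nf
  calc Real.exp (L / 4) * (Real.log q + Real.log 5) * (KJ * (Real.log q + Real.log 4)) * (q * L)
      ≤ Real.exp (L / 4) * L * (KJ * L) * (Real.exp (L / 9) * L) := by gcongr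
    _ = Real.exp (L / 4) * (c₀ * (KJ / c₀ * L ^ 3)) * Real.exp (L / 9) := by
        field_simp
    _ ≤ Real.exp (L / 4) * (c₀ * Real.exp (23 / 36 * L)) * Real.exp (L / 9) := by gcongr
    _ = x * c₀ := e

/-- The constant `C(χ)`: `C₅ (log q + 7)⁴ (1/(1 − β) + 1) ≤ x/(qL)` with Siegel's bound
`1/(1 − β) ≤ q/C_S`. [folklore] -/
theorem const_term_le (hx : x = Real.exp L) (hq1 : 1 ≤ q) (hqL : q ≤ Real.exp (L / 9))
    (hlogq : Real.log q ≤ L / 9) (hL : 18 ≤ L) {C₅ CS β : ℝ} (hC₅ : 0 ≤ C₅)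
    (hβ : 0 < 1 - β) (hS : 1 / (1 - β) ≤ q / CS)
    (h : C₅ * (CS⁻¹ + 1) * L ^ 5 ≤ Real.exp (7 / 9 * L)) :
    C₅ * (Real.log q + 7) ^ 4 * (1 / (1 - β) + 1) ≤ x / (q * L) := by
  have hq0 : 0 < q := by linarith
  have hL0 : 0 < L := by linarith
  have hlogq0 : 0 ≤ Real.log q := Real.log_nonneg hq1
  have hA : Real.log q + 7 ≤ L := by linarith
  have hA4 : (Real.log q + 7) ^ 4 ≤ L ^ 4 := pow_le_pow_left₀ (by positivity) hA 4
  have hS' : 1 / (1 - β) + 1 ≤ q * (CS⁻¹ + 1) := by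
    have : (1 : ℝ) ≤ q * 1 := by linarith
    calc 1 / (1 - β) + 1 ≤ q / CS + q * 1 := add_le_add hS this
      _ = q * (CS⁻¹ + 1) := by ring
  rw [le_div_iff₀ (by positivity), hx]
  have e : Real.exp (7 / 9 * L) * Real.exp (L / 9) * Real.exp (L / 9) = Real.exp L := by
    rw [← Real.exp_add, ← Real.exp_add]; ring_nf
  calc C₅ * (Real.log q + 7) ^ 4 * (1 / (1 - β) + 1) * (q * L)
      ≤ C₅ * L ^ 4 * (q * (CS⁻¹ + 1)) * (q * L) := by gcongr
    _ = C₅ * (CS⁻¹ + 1) * L ^ 5 * q * q := by ring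
    _ ≤ Real.exp (7 / 9 * L) * Real.exp (L / 9) * Real.exp (L / 9) := by gcongr
    _ = Real.exp L := e

/-- The hypothesis `x ≥ T^{C'}` of (3.2) for `T = qL³`, from `x > q^C` (`C' < C`) and
`L^{3C'} ≤ x^{1 − C'/C}`. [folklore] -/
theorem rpow_T_le (hx : x = Real.exp L) (hq1 : 1 ≤ q) (hL : 1 ≤ L) {C C' T : ℝ}
    (hC' : 0 < C') (hlogq : Real.log q ≤ L / C) (hT : T = q * L ^ 3)
    (h : L ^ (3 * C') ≤ Real.exp ((1 - C' / C) * L)) : T ^ C' ≤ x := by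
  have hq0 : 0 < q := by linarith
  have hL0 : 0 < L := by linarith
  have hqC : q ^ C' ≤ Real.exp (C' / C * L) := by
    rw [Real.rpow_def_of_pos hq0]
    exact Real.exp_le_exp.2 (by
      calc Real.log q * C' ≤ L / C * C' := by gcongr
        _ = C' / C * L := by ring)
  have hL3 : (L ^ 3) ^ C' = L ^ (3 * C') := by
    rw [show L ^ 3 = L ^ ((3 : ℕ) : ℝ) by rw [Real.rpow_natCast], ← Real.rpow_mul hL0.le]
    norm_num
  rw [hT, Real.mul_rpow hq0.le (by positivity), hL3, hx]
  calc q ^ C' * L ^ (3 * C') ≤ Real.exp (C' / C * L) * Real.exp ((1 - C' / C) * L) := by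
        gcongr
    _ = Real.exp L := by rw [← Real.exp_add]; ring_nf

end Terms

end Literature.NumberTheory.LFunctions.SiegelZero

end
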